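import Summits.ValiantsHypothesis.ValiantsHypothesis.Theorems.FeketeSOSFeketeSOSHardPaleyRIPDefs
import Summits.ValiantsHypothesis.ValiantsHypothesis.Theorems.FeketeSOSFeketeSOSHardGoodReductionTransfer

/-!
# Route FeketeSOS — crux `FeketeSOSHard` (stmt-ValiantsHypothesis-3996), line `paley-rip`:
# `stub_tameReduction` minus its mass clause is the cyclic fold

Companion of `…PaleyRIPTameStatus.lean`.  The open stub C = `stub_tameReduction` of the line of record
`Cruxes/FeketeSOSHard/Lines/paley_rip.lean` asks that a cheap complex representation `Σ_i c_i g_i² = F_p`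
(few sparse squares of degree `≤ p²`) be traded for a CYCLIC representation `X^p − 1 ∣ Σ_j c'_j g'_j² − F_p`
with `deg g'_j < p`, every `#supp g'_j ≤ p^{1/2+δ₁}`, AND archimedean mass `Σ_j |c'_j|·‖g'_j‖₂² ≤ p^{1/2+η}`.
This file records, sorry-free, that every clause except the last is free — with `δ = δ₁`, the same weights
and the same number of squares, and without any hypothesis on `s`, the degrees or `p`:

* `exists_cyclic_fold` — the cyclic folds `g'_j = Σ_{n∈supp g_j} g_j(n) X^{n mod p}` of any representation
  modulo `X^p − 1` have `deg < p`, no more monomials, and represent `F_p` modulo `X^p − 1` (tree fold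
  lemmas `FeketeSOSHardSketch.grt_*`, p87210);
* `tameReduction_sans_mass` / `tameReduction_sans_mass_of_eq` — hence the conclusion of C with the mass
  clause deleted.

So the content of C is the single inequality on the mass, which (`…TameStatus.mass_gt_of_flatRIPAt`) is
unsatisfiable wherever the engine `stub_paleyFlatRIP` holds: C is the crux modulo the engine.  Honest
framing: nothing here proves C or the crux; `VP ≠ VNP` is not touched.
-/

set_option linter.dupNamespace false

namespace Summit.ValiantsHypothesis.ValiantsHypothesis.Theorems.FeketeSOSHardPaleyRIP

open Polynomial Finset
open scoped BigOperators

noncomputable section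

/-! ## The mass clause is the whole content: everything else in C is the cyclic fold -/

section Fold

variable (p : ℕ) [Fact p.Prime]

/-- **Cyclic fold of a representation.**  If `X^p − 1 ∣ Σ_i c_i g_i² − F_p` over `ℂ` (in particular if
`Σ_i c_i g_i² = F_p`, any degrees), then the cyclic folds `g'_j = Σ_{n ∈ supp g_j} g_j(n) X^{n mod p}`
satisfy `deg g'_j < p`, `#supp g'_j ≤ #supp g_j`, and `X^p − 1 ∣ Σ_j c_j g'_j² − F_p` (same weights, same
number of squares).  Tree fold lemmas `FeketeSOSHardSketch.grt_*`. [folklore] -/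
theorem exists_cyclic_fold (s : ℕ) (c : Fin s → ℂ) (g : Fin s → ℂ[X])
    (hdvd : (X : ℂ[X]) ^ p - 1 ∣ (∑ i, C (c i) * g i ^ 2) - fek p) :
    ∃ g' : Fin s → ℂ[X], (∀ j, (g' j).natDegree < p) ∧
      (∀ j, (g' j).support.card ≤ (g j).support.card) ∧
      ((X : ℂ[X]) ^ p - 1 ∣ (∑ j, C (c j) * g' j ^ 2) - fek p) := by
  classical
  have hp0 : 0 < p := (Fact.out : p.Prime).pos
  refine ⟨fun j => ∑ n ∈ (g j).support, C ((g j).coeff n) * X ^ (n % p),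
    fun j => FeketeSOSHardSketch.grt_natDegree_fold_lt _ hp0,
    fun j => FeketeSOSHardSketch.grt_card_support_fold_le _ _, ?_⟩
  have h1 : (X : ℂ[X]) ^ p - 1 ∣
      (∑ j, C (c j) * (∑ n ∈ (g j).support, C ((g j).coeff n) * X ^ (n % p)) ^ 2) -
        ∑ j, C (c j) * g j ^ 2 := by
    rw [← Finset.sum_sub_distrib]
    refine Finset.dvd_sum fun j _ => ?_
    have e : C (c j) * (∑ n ∈ (g j).support, C ((g j).coeff n) * X ^ (n % p)) ^ 2 - C (c j) * g j ^ 2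
        = C (c j) * ((∑ n ∈ (g j).support, C ((g j).coeff n) * X ^ (n % p)) + g j) *
          ((∑ n ∈ (g j).support, C ((g j).coeff n) * X ^ (n % p)) - g j) := by ring
    rw [e]
    exact Dvd.dvd.mul_left (FeketeSOSHardSketch.grt_X_pow_sub_one_dvd_fold_sub (g j) p) _
  have h2 := dvd_add h1 hdvd
  rwa [sub_add_sub_cancel] at h2

/-- **`stub_tameReduction` without its mass clause is a theorem** — indeed with `δ = δ₁`, the same weights,
the same number of squares, no hypothesis on `s`, on the degrees or on `p`, and for representations that
are only cyclic to begin with: a representation of support-sum `≤ p^{1/2+δ₁}` folds to a cyclic one with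
`deg < p`, every `#supp ≤ p^{1/2+δ₁}`, and support-sum no larger.  The open content of the stub is therefore
the single inequality `Σ_j |c'_j| Σ_a |g'_j(a)|² ≤ p^{1/2+η}` (`η < κ`), which by `mass_gt_of_flatRIPAt` is
unsatisfiable wherever the engine holds. [folklore] -/
theorem tameReduction_sans_mass (δ₁ : ℝ) (s : ℕ) (c : Fin s → ℂ) (g : Fin s → ℂ[X])
    (hdvd : (X : ℂ[X]) ^ p - 1 ∣ (∑ i, C (c i) * g i ^ 2) - fek p)
    (hsum : (∑ i, ((g i).support.card : ℝ)) ≤ (p : ℝ) ^ (1 / 2 + δ₁)) :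
    ∃ g' : Fin s → ℂ[X],
      (∀ j, (g' j).natDegree < p) ∧
      (∀ j, ((g' j).support.card : ℝ) ≤ (p : ℝ) ^ (1 / 2 + δ₁)) ∧
      ((X : ℂ[X]) ^ p - 1 ∣ (∑ j, C (c j) * g' j ^ 2) - fek p) ∧
      (∑ j, ((g' j).support.card : ℝ)) ≤ ∑ i, ((g i).support.card : ℝ) := by
  classical
  obtain ⟨g', hdeg', hcard', hdvd'⟩ := exists_cyclic_fold p s c g hdvd
  refine ⟨g', hdeg', fun j => ?_, hdvd', sum_le_sum fun j _ => by exact_mod_cast hcard' j⟩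
  calc ((g' j).support.card : ℝ) ≤ ((g j).support.card : ℝ) := by exact_mod_cast hcard' j
    _ ≤ ∑ i, ((g i).support.card : ℝ) :=
        Finset.single_le_sum (f := fun i => ((g i).support.card : ℝ)) (fun i _ => Nat.cast_nonneg _)
          (Finset.mem_univ j)
    _ ≤ (p : ℝ) ^ (1 / 2 + δ₁) := hsum

/-- The exact-representation case (the crux's hypothesis `Σ_i c_i g_i² = F_p`, degrees `≤ p²` or any):
`stub_tameReduction`'s conclusion holds with the mass clause deleted, for `δ = δ₁` and `s' = s`. [folklore] -/
theorem tameReduction_sans_mass_of_eq (δ₁ : ℝ) (s : ℕ) (c : Fin s → ℂ) (g : Fin s → ℂ[X])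
    (hrep : (∑ i, C (c i) * g i ^ 2) = fek p)
    (hsum : (∑ i, ((g i).support.card : ℝ)) < (p : ℝ) ^ (1 / 2 + δ₁)) :
    ∃ (s' : ℕ) (c' : Fin s' → ℂ) (g' : Fin s' → ℂ[X]),
      (∀ j, (g' j).natDegree < p) ∧
      (∀ j, ((g' j).support.card : ℝ) ≤ (p : ℝ) ^ (1 / 2 + δ₁)) ∧
      ((X : ℂ[X]) ^ p - 1 ∣ (∑ j, C (c' j) * g' j ^ 2) - fek p) := by
  have hdvd : (X : ℂ[X]) ^ p - 1 ∣ (∑ i, C (c i) * g i ^ 2) - fek p := by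
    rw [hrep, sub_self]; exact dvd_zero _
  obtain ⟨g', hdeg', hsupp', hdvd', -⟩ := tameReduction_sans_mass p δ₁ s c g hdvd hsum.le
  exact ⟨s, c, g', hdeg', hsupp', hdvd'⟩

end Fold

end

end Summit.ValiantsHypothesis.ValiantsHypothesis.Theorems.FeketeSOSHardPaleyRIP
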